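import Summits.BirchSwinnertonDyer.Rank1Residual.X9.PrintCertHowardCensus
import Summits.BirchSwinnertonDyer.BirchSwinnertonDyer.Theorems.PrintX9CertImageKernel
import Summits.BirchSwinnertonDyer.BirchSwinnertonDyer.Theorems.PrintX9HowardRankOne
import Summits.BirchSwinnertonDyer.Rank1Residual.X10.LeafDischargeX10bHoward
import Literature.NumberTheory.QuadraticFields.FundamentalDiscriminant
import Literature.NumberTheory.EllipticCurves.HeegnerPointsImaginaryQuadraticProofs
import HarnessLib

/-!
# Leaves X9 / X10b — HOWARD FRAME certificates as DOORS: the frame supply `hFS` / `hFS₃` of the J-free Howard road,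
# discharged PER PAIR, and `BSD(E,p)` per certified rank-`1` record modulo the road's print facts, its engine and two claims (records v4)

HONEST FRAMING (cell `bsd-print-x9`, D-0131 (2) print tier): theorems only; no named fact; nothing asserted about any elliptic
curve beyond what the kernel rechecks; NO pair is booked and NO leaf is closed by this file (`BSDpOnClassX9`, `BSDpOnClassX10b`,
`IntegralMainConjectureOnClassX9`, `X10.MazurMainConjectureOnClassX10b` stay `@[conjecture]`; every `BSD(E,p)` conclusion below is
CONDITIONAL on the binders printed in its signature). Companion of `X9/PrintCertHoward.lean` (v4 tool), `X9/PrintCertHowardCerts.lean`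
(data), `X9/PrintCertHowardCertified*.lean` (kernel), `X9/PrintCertHowardCensus.lean` (one-stop).

WHY. The J-free Howard road of the cell (prover p4 gen 3, `Theorems/PrintX9HowardRankOne.lean`:
`X9.bsdp_rankOne_of_howardFrame_of_x9IntegralMainConjecture`; its `p = 3` twin by typer ty2 gen 8, `X10/LeafDischargeX10bHoward.lean`:
`X10b.bsdp_rankOne_of_howardFrame_of_mazurMainConjectureOnClassX10b`) proves `BSD(E,p)` for a rank-`1` pair of the leaf from the road's
published inputs, the leaf's typed rank-`0` engine, and ONE MORE INPUT: a HOWARD FRAME — an imaginary quadratic `K` with `d_K` odd `< −4`,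
every `ℓ ∣ N_E` and `p` split, `p ∤ h_K`, and `L(E^{d_K}, 1) ≠ 0`; class-wide this is the OPEN frame supply `hFS` (X9) / `hFS₃` (X10b) of
`bsdpOnClassX9_of_heegnerFrameSupply_of_cor46_…` / `X10.bsdpOnClassX10b_of_heegnerFrameSupply_of_cor46_…` (beyond print class-wide at
`p ≥ 5`, lit DOSSIER §36). PER PAIR the frame supply is a finite certificate, and records v4 carries one for EVERY rank-`1` census record:
this file turns a passing Howard frame certificate into the frame supply AT THE PAIR — the field `K := ℚ(√D)` is PRODUCED (existence of a
quadratic field of fundamental discriminant `D`, `Quadratic.exists_numberField_discr_eq`, from the certificate's trial-division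
squarefreeness recheck made sound here), with `IsImaginaryQuadratic K`, `Odd d_K`, `d_K < −4`, the Heegner hypothesis for `N(W)` and for `p`,
and `p ∤ h_K` ALL IN THE KERNEL — leaving exactly ONE analytic CLAIM per frame, `L(E^D, 1) ≠ 0` (two engines: exact `L_ratio ≠ 0`, PARI
`ellL1`), in the road's own currency `(W.quadraticTwist (D : ℚ)).entireLFunction 1 ≠ 0`, plus the record's analytic-rank claim.

* `squarefree_of_sqfreeNat` (soundness of the v3 trial-division test), `Record.isFundDisc_of_heegnerCheck`,
  `Record.fundamental_of_howardCheck` (`D ≡ 1 (mod 4)`, `Squarefree D`, `D ≠ 1`), `Record.exists_field_of_howardCheck`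
  (`∃ K, IsImaginaryQuadratic K ∧ d_K = D`).
* `Record.frameSupply_of_howardCheck hI hc hh hq hLt` — THE FRAME SUPPLY AT THE PAIR: the body of `hFS` / `hFS₃` for `(W, q)`, from a
  passing Howard check and the claim `hLt`.
* `Record.bsdp_of_howardCheck_of_x9IntegralMainConjecture` (X9, `p ≥ 5`) and `Record.bsdp_three_of_howardCheck_of_mazurMainConjectureOnClassX10b`
  (X10b) — `BSD(E,p)` for ANY globally minimal `W` with the record's integral model, from: the road's print binders VERBATIM (as in the two
  road theorems), the engine (`IntegralMainConjectureOnClassX9` resp. `X10.MazurMainConjectureOnClassX10b`), the record recheck + image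
  certificate (leaf predicate and `¬Surj` in the kernel, p1's `Record.classX9_of_check_kernel` / `classX10b_of_check_kernel`), the Howard
  certificate, and the two CLAIMS `hrank : W.analyticRank = r.rank`, `hLt`. NO J / J₃, NO Schneider, ANY Tamagawa depth.
* over the census lists: `bsdp_of_mem_allX9_of_howard_of_x9IntegralMainConjecture`, `bsdp_of_mem_allX10b_of_howard_of_mazurMainConjectureOnClassX10b`
  (the claim `hL` ranges over the record's listed Howard certificates), and the kernel facts `five_le_p_of_mem_allX9`, `imageCert_of_mem_allX9/allX10b`.

References: [MastellaZerman2026] Assumption 2.1, Cor. 4.6; [Howard2004HeegnerKolyvagin] Thm. B; [Cox2013] §2.A Thm. 2.13, §7.B Thm. 7.7(ii);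
[Marcus1977] Ch. 2 Thm. 1, Ch. 3 Thm. 25; [GrossZagier1986] I §3; [Miller2011LMS] Def. 1.1.
-/

set_option autoImplicit false

noncomputable section

open scoped Classical

open WeierstrassCurve NumberField IsDedekindDomain Literature.NumberTheory.EllipticCurves
  Literature.NumberTheory.EllipticCurves.ModularForms
  Literature.NumberTheory.EllipticCurves.BurungaleCastellaSkinner2025
  Literature.NumberTheory.EllipticCurves.JetchevSkinnerWan2017
  Literature.NumberTheory.EllipticCurves.YanZhu2026
  Summit.BirchSwinnertonDyer.BirchSwinnertonDyer.Theorems.Rank1ResidualX1Defs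
  Summit.BirchSwinnertonDyer.Rank1Residual
  Summit.BirchSwinnertonDyer.Rank1Residual.Additive

open Literature.NumberTheory.EllipticCurves.Rank1Residual (GoodOrd Irr Surj ClassX10)
open Literature.NumberTheory.QuadraticFields (Quadratic.exists_numberField_discr_eq)

namespace Summit.BirchSwinnertonDyer.Rank1Residual.X9.PrintCert

/-! ### §1 Soundness of the trial-division squarefreeness test; the certificate's `D` is a fundamental discriminant; the field `ℚ(√D)` -/

/-- The records-v3 trial-division test `sqfreeNat` is SOUND: `sqfreeNat n = true` (no `k² ∣ n` for `2 ≤ k ≤ √n`) implies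
`Squarefree n` for `n ≠ 0`. [folklore] -/
theorem squarefree_of_sqfreeNat {n : ℕ} (hn : n ≠ 0) (h : sqfreeNat n = true) : Squarefree n := by
  intro x hx
  rw [Nat.isUnit_iff]
  by_contra hx1
  have hx0 : x ≠ 0 := by
    rintro rfl
    exact hn (by simpa using hx)
  have hle : x * x ≤ n := Nat.le_of_dvd (Nat.pos_of_ne_zero hn) hx
  have hxs : x ≤ Nat.sqrt n := Nat.le_sqrt.mpr hle
  simp only [sqfreeNat, List.all_eq_true, List.mem_range, decide_eq_true_eq] at h
  rcases h x (by omega) with h2 | hmod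
  · omega
  · exact hmod (Nat.mod_eq_zero_of_dvd hx)

namespace Record

variable {r : Record}

/-- Unpacking the discriminant part of a passing Heegner check further than `disc_of_heegnerCheck`: the Boolean fundamental-discriminant
test passed. [cite: Cox2013, §7.B (p. 137)] -/
theorem isFundDisc_of_heegnerCheck {c : HeegnerCert} (h : r.heegnerCheck c = true) : isFundDisc c.D = true := by
  have h' := (parts_of_heegnerCheck h).2.1
  simp only [passHDisc, Bool.and_eq_true, decide_eq_true_eq] at h'
  exact h'.1.1.1.1.1.2

/-- **The Howard certificate's `D` is an odd fundamental discriminant**: `D ≡ 1 (mod 4)`, `Squarefree D`, `D ≠ 1` (the hypothesis shape of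
`Quadratic.exists_numberField_discr_eq`), IN THE KERNEL's currency (trial division made sound by `squarefree_of_sqfreeNat`).
[cite: Cox2013, §7.B (p. 137)] -/
theorem fundamental_of_howardCheck {c : HeegnerCert} (hh : r.howardCheck c = true) :
    c.D % 4 = 1 ∧ Squarefree c.D ∧ c.D ≠ 1 := by
  have hF := isFundDisc_of_heegnerCheck (heegnerCheck_of_howardCheck hh)
  have hodd := (classNumber_of_howardCheck hh).1
  have hD0 := (disc_of_heegnerCheck (heegnerCheck_of_howardCheck hh)).1
  simp only [isFundDisc, Bool.or_eq_true, Bool.and_eq_true, decide_eq_true_eq] at hF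
  rcases hF with ⟨h4, hsq⟩ | ⟨⟨h40, -⟩, -⟩
  · refine ⟨h4, ?_, by omega⟩
    have hn : c.D.natAbs ≠ 0 := by omega
    exact Int.squarefree_natAbs.mp (squarefree_of_sqfreeNat hn hsq)
  · omega

/-- **The frame field exists**: there is an imaginary quadratic number field `K` (a `Type`) with `d_K = D` — Marcus Ch. 2 Thm. 1 through the
tree's `Quadratic.exists_numberField_discr_eq`, and `d_K < 0`. [cite: Marcus1977, Ch. 2 Thm. 1] -/
theorem exists_field_of_howardCheck {c : HeegnerCert} (hh : r.howardCheck c = true) :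
    ∃ (K : Type) (_ : Field K) (_ : NumberField K), IsImaginaryQuadratic K ∧ NumberField.discr K = c.D := by
  obtain ⟨h4, hsq, h1⟩ := fundamental_of_howardCheck hh
  obtain ⟨K, _, _, hK2, hd⟩ := Quadratic.exists_numberField_discr_eq (Or.inl ⟨h4, hsq, h1⟩)
  have hD0 := (disc_of_heegnerCheck (heegnerCheck_of_howardCheck hh)).1
  exact ⟨K, _, _, isImaginaryQuadratic_iff_discr_neg.2 ⟨hK2, by rw [hd]; exact hD0⟩, hd⟩

/-! ### §2 The frame supply AT THE PAIR -/

variable {W : WeierstrassCurve ℚ} [W.IsElliptic] [W.IsGloballyMinimal] (hI : integralModelInt W = r.intCurve)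
include hI

/-- **THE FRAME SUPPLY AT THE PAIR.** For any globally minimal `W` with the record's integral model and a passing Howard frame certificate
`c`, GRANTED the claim `L(E^D,1) ≠ 0` in the road's currency: there is an imaginary quadratic `K` (namely any `ℚ(√D)`) with `Odd d_K`,
`d_K < −4`, the Heegner hypothesis for `N(W)` and for `q = r.p`, `q ∤ h_K`, and `L(E^{d_K}, 1) ≠ 0` — the body of the frame-supply binder
`hFS` of `bsdpOnClassX9_of_heegnerFrameSupply_of_cor46_of_integralMainConjectureOnClassX9` (X9) and of `hFS₃` of
`X10.bsdpOnClassX10b_of_heegnerFrameSupply_of_cor46_of_mazurMainConjectureOnClassX10b` (X10b) AT THIS PAIR. Everything except `hLt` is kernel.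
[cite: MastellaZerman2026, Assumption 2.1, Cor. 4.6] [cite: Cox2013, §7.B Thm. 7.7(ii)] [cite: Marcus1977, Ch. 2 Thm. 1, Ch. 3 Thm. 25] -/
theorem frameSupply_of_howardCheck (hc : r.check = true) {c : HeegnerCert} (hh : r.howardCheck c = true) {q : ℕ} (hq : q = r.p)
    (hLt : (W.quadraticTwist (c.D : ℚ)).entireLFunction 1 ≠ 0) :
    ∃ (K : Type) (_ : Field K) (_ : NumberField K), IsImaginaryQuadratic K ∧
      Odd (NumberField.discr K) ∧ NumberField.discr K < -4 ∧
      SatisfiesHeegnerHypothesis (W.conductorNorm ℤ) K ∧ SatisfiesHeegnerHypothesis q K ∧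
      ¬ q ∣ NumberField.classNumber K ∧
      (W.quadraticTwist (NumberField.discr K : ℚ)).entireLFunction 1 ≠ 0 := by
  obtain ⟨K, _, _, hK, hd⟩ := exists_field_of_howardCheck hh
  obtain ⟨⟨hHN, hHp, h4, -, -⟩, hodd, -, hhK⟩ := howardFrame_of_howardCheck hI hc hh hK hd hq
  have hD0 := (disc_of_heegnerCheck (heegnerCheck_of_howardCheck hh)).1
  refine ⟨K, _, _, hK, hodd, ?_, hHN, hHp, hhK, ?_⟩
  · rw [hd] at h4 ⊢
    omega
  · rw [hd]
    exact hLt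

/-! ### §3 `BSD(E,p)` per certified rank-`1` record on the Howard road (X9: `p ≥ 5`; X10b: `p = 3`) -/

/-- **X9 DOOR (`p ≥ 5`).** `BSD(E,q)` for ANY globally minimal `W` with the record's integral model, from: the Howard road's published
binders VERBATIM (`X9.bsdp_rankOne_of_howardFrame_of_x9IntegralMainConjecture`, p4 gen 3), the K6 engine `IntegralMainConjectureOnClassX9`
(OPEN, `@[conjecture]`), the record recheck and image certificate (leaf predicate with `¬Surj` in the kernel, `Record.classX9_of_check_kernel`),
a passing Howard frame certificate (frame, `d_K` odd, `p ∤ h_K` in the kernel), and the two CLAIMS `hrank` (analytic rank of the record) and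
`hLt` (`L(E^D,1) ≠ 0`). NO crux J, NO Schneider, ANY Tamagawa depth. Nothing is booked by this theorem.
[cite: MastellaZerman2026, Cor. 4.6] [cite: Howard2004HeegnerKolyvagin, Thm. B] [cite: Miller2011LMS, Def. 1.1] -/
theorem bsdp_of_howardCheck_of_x9IntegralMainConjecture
    (h46 : MastellaZerman2026.cor46_howardDivisibility_of_scalarImage.{0})
    (hYZ : thm57_thm59_bcs422_cgls513_generator_constantCoeff_of_heegnerDivisibility)
    (h331 : thm331_anticyclotomicControl)
    (hGZ : ∀ (N : ℕ) [NeZero N] (W : WeierstrassCurve ℚ) (K : Type) [Field K] [NumberField K],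
      gross_zagier N W K)
    (hKo : ∀ (N : ℕ) [NeZero N] (W : WeierstrassCurve ℚ) (K : Type) [Field K] [NumberField K],
      kolyvagin N W K)
    (hGr : greenberg_charValue_rankZero) (hGZK : rank_eq_analyticRank_of_analyticRank_le_one)
    (hmod : hasEntireLFunction_rat) (hpar : nonempty_modularParametrizationData)
    (hnf : exists_isNewformOf)
    (hMaz : mazur_not_dvd_maninConstant_of_odd) (hNS : integral_neronScaling_of_isGloballyMinimal)
    (h5 : realPeriodRat_eq_unit_mul_plusPeriod)
    (hc : r.check = true) (hsome : r.imageCert.isSome = true) {c : HeegnerCert} (hh : r.howardCheck c = true)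
    {q : ℕ} [Fact q.Prime] (hq : q = r.p) (hp5 : 5 ≤ q) (hrank : W.analyticRank = r.rank)
    (hLt : (W.quadraticTwist (c.D : ℚ)).entireLFunction 1 ≠ 0)
    (hIMC : _root_.Summit.BirchSwinnertonDyer.BirchSwinnertonDyer.Rank1Residual.IntegralMainConjectureOnClassX9) :
    BSDp W q := by
  have hr : W.analyticRank = 1 := hrank.trans (keys_of_heegnerCheck (heegnerCheck_of_howardCheck hh)).2
  have hX9 := r.classX9_of_check_kernel hI hc hsome hq hp5 hrank
  obtain ⟨K, _, _, hK, hodd, hlt, hHN, hHp, hhK, hLt'⟩ := frameSupply_of_howardCheck hI hc hh hq hLt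
  exact _root_.Summit.BirchSwinnertonDyer.BirchSwinnertonDyer.Rank1Residual.X9.bsdp_rankOne_of_howardFrame_of_x9IntegralMainConjecture
    h46 hYZ h331 hGZ hKo hGr hGZK hmod hpar hnf hMaz hNS h5 W q
    (_root_.Summit.BirchSwinnertonDyer.BirchSwinnertonDyer.Rank1Residual.classX9_of_classX9_census W q hX9) hr
    K hK hodd hlt hHN hHp hhK hLt' hIMC

/-- **X10b DOOR (`p = 3`).** `BSD(E,3)` for ANY globally minimal `W` with the record's integral model, from: the road's published binders
VERBATIM (`X10b.bsdp_rankOne_of_howardFrame_of_mazurMainConjectureOnClassX10b`, ty2 gen 8), the X10b engine `X10.MazurMainConjectureOnClassX10b`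
(OPEN, `@[conjecture]`), the record recheck and image certificate (`ClassX10 W 3 ∧ ¬Surj W 3` in the kernel, `Record.classX10b_of_check_kernel`;
`¬CM` by `Record.not_hasCM_of_check`), a passing Howard frame certificate (`d_K ≡ 1 (mod 8)`, `3 ∤ h_K` in the kernel), and the two CLAIMS
`hrank`, `hLt`. NO crux J₃, NO Cha, NO Schneider, ANY Tamagawa depth. Nothing is booked by this theorem.
[cite: MastellaZerman2026, Cor. 4.6] [cite: Howard2004HeegnerKolyvagin, Thm. B] [cite: Miller2011LMS, Def. 1.1] -/
theorem bsdp_three_of_howardCheck_of_mazurMainConjectureOnClassX10b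
    (h46 : MastellaZerman2026.cor46_howardDivisibility_of_scalarImage.{0})
    (hYZ : thm57_thm59_bcs422_cgls513_generator_constantCoeff_of_heegnerDivisibility)
    (h331 : thm331_anticyclotomicControl)
    (hGZ : ∀ (N : ℕ) [NeZero N] (W : WeierstrassCurve ℚ) (K : Type) [Field K] [NumberField K],
      gross_zagier N W K)
    (hKo : ∀ (N : ℕ) [NeZero N] (W : WeierstrassCurve ℚ) (K : Type) [Field K] [NumberField K],
      kolyvagin N W K)
    (hGr : greenberg_charValue_rankZero) (hGZK : rank_eq_analyticRank_of_analyticRank_le_one)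
    (hmod : hasEntireLFunction_rat) (hpar : nonempty_modularParametrizationData)
    (hnf : exists_isNewformOf)
    (hMaz : mazur_not_dvd_maninConstant_of_odd) (hNS : integral_neronScaling_of_isGloballyMinimal)
    (hc : r.check = true) (hsome : r.imageCert.isSome = true) {c : HeegnerCert} (hh : r.howardCheck c = true)
    (hp3 : r.p = 3) (hrank : W.analyticRank = r.rank)
    (hLt : (W.quadraticTwist (c.D : ℚ)).entireLFunction 1 ≠ 0)
    (hA3 : X10.MazurMainConjectureOnClassX10b) : BSDp W 3 := by
  have hr : W.analyticRank = 1 := hrank.trans (keys_of_heegnerCheck (heegnerCheck_of_howardCheck hh)).2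
  obtain ⟨hX, hns⟩ := r.classX10b_of_check_kernel hI hc hsome hp3 hrank
  have hcm := r.not_hasCM_of_check hI hc
  obtain ⟨K, _, _, hK, hodd, hlt, hHN, hHp, hhK, hLt'⟩ := frameSupply_of_howardCheck hI hc hh hp3.symm hLt
  exact X10b.bsdp_rankOne_of_howardFrame_of_mazurMainConjectureOnClassX10b h46 hYZ h331 hGZ hKo hGr hGZK hmod hpar hnf
    hMaz hNS W 3 hX hns hcm hr K hK hodd hlt hHN hHp hhK hLt' hA3

end Record

/-! ### §4 Over the census lists `allX9` / `allX10b` -/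

-- kernel evaluation over the 1103 records
set_option maxRecDepth 100000

/-- Every X9 census record has `p ≥ 5` (kernel). [folklore] -/
theorem five_le_p_of_mem_allX9 : ∀ r ∈ allX9, 5 ≤ r.p := by
  have h : (allX9.all fun r => decide (5 ≤ r.p)) = true := by decide +kernel
  intro r hr
  simpa using List.all_eq_true.1 h r hr

/-- Every X10b census record has `p = 3` (kernel). [folklore] -/
theorem p_eq_three_of_mem_allX10b : ∀ r ∈ allX10b, r.p = 3 := by
  have h : (allX10b.all fun r => decide (r.p = 3)) = true := by decide +kernel
  intro r hr
  simpa using List.all_eq_true.1 h r hr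

/-- Every X9 census record carries an image certificate (the slices' `imageCert_<Slice>`). [folklore] -/
theorem imageCert_of_mem_allX9 {r : Record} (hr : r ∈ allX9) : r.imageCert.isSome = true := by
  simp only [allX9, List.mem_append] at hr
  rcases hr with ((((((((h | h) | h) | h) | h) | h) | h) | h) | h) | h
  exacts [imageCert_Ns5A r h, imageCert_Ns5B r h, imageCert_Ns7 r h, imageCert_S4R0A r h, imageCert_S4R0B r h,
    imageCert_S4R0C r h, imageCert_S4R1A r h, imageCert_S4R1B r h, imageCert_S4R1C r h, imageCert_S4R1D r h]

/-- Every X10b census record carries an image certificate (the slices' `imageCert_<Slice>`). [folklore] -/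
theorem imageCert_of_mem_allX10b {r : Record} (hr : r ∈ allX10b) : r.imageCert.isSome = true := by
  simp only [allX10b, List.mem_append] at hr
  rcases hr with ((h | h) | h) | h
  exacts [imageCert_X10bNn r h, imageCert_X10bNsR0A r h, imageCert_X10bNsR0B r h, imageCert_X10bNsR1 r h]

/-- **X9 DOOR over `allX9`.** For a rank-`1` X9 census record and ANY globally minimal `W` with its integral model: `BSD(E,q)` from the
Howard road's print binders, the K6 engine, and the CLAIMS `hrank` (analytic rank) and `hL` (non-vanishing of `L(E^D,1)` for the record's
listed Howard frames — one exact `L_ratio ≠ 0` certificate each, two engines; only the frame the kernel found is used).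
NO crux J, ANY Tamagawa depth; nothing booked. [cite: MastellaZerman2026, Cor. 4.6] [cite: Miller2011LMS, Def. 1.1] -/
theorem bsdp_of_mem_allX9_of_howard_of_x9IntegralMainConjecture
    (h46 : MastellaZerman2026.cor46_howardDivisibility_of_scalarImage.{0})
    (hYZ : thm57_thm59_bcs422_cgls513_generator_constantCoeff_of_heegnerDivisibility)
    (h331 : thm331_anticyclotomicControl)
    (hGZ : ∀ (N : ℕ) [NeZero N] (W : WeierstrassCurve ℚ) (K : Type) [Field K] [NumberField K],
      gross_zagier N W K)
    (hKo : ∀ (N : ℕ) [NeZero N] (W : WeierstrassCurve ℚ) (K : Type) [Field K] [NumberField K],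
      kolyvagin N W K)
    (hGr : greenberg_charValue_rankZero) (hGZK : rank_eq_analyticRank_of_analyticRank_le_one)
    (hmod : hasEntireLFunction_rat) (hpar : nonempty_modularParametrizationData)
    (hnf : exists_isNewformOf)
    (hMaz : mazur_not_dvd_maninConstant_of_odd) (hNS : integral_neronScaling_of_isGloballyMinimal)
    (h5 : realPeriodRat_eq_unit_mul_plusPeriod)
    {r : Record} (hr : r ∈ allX9) (h1 : r.rank = 1) {W : WeierstrassCurve ℚ} [W.IsElliptic] [W.IsGloballyMinimal]
    (hI : integralModelInt W = r.intCurve) {q : ℕ} [Fact q.Prime] (hq : q = r.p) (hrank : W.analyticRank = r.rank)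
    (hL : ∀ c ∈ howardCertsAllX9, r.howardCheck c = true → (W.quadraticTwist (c.D : ℚ)).entireLFunction 1 ≠ 0)
    (hIMC : _root_.Summit.BirchSwinnertonDyer.BirchSwinnertonDyer.Rank1Residual.IntegralMainConjectureOnClassX9) :
    BSDp W q := by
  obtain ⟨c, hc, hh⟩ := exists_howardCheck_of_mem_allX9 hr h1
  exact Record.bsdp_of_howardCheck_of_x9IntegralMainConjecture hI h46 hYZ h331 hGZ hKo hGr hGZK hmod hpar hnf hMaz hNS h5
    (check_of_mem_allX9 hr) (imageCert_of_mem_allX9 hr) hh hq (by rw [hq]; exact five_le_p_of_mem_allX9 r hr) hrank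
    (hL c hc hh) hIMC

/-- **X10b DOOR over `allX10b`.** For a rank-`1` X10b census record and ANY globally minimal `W` with its integral model: `BSD(E,3)` from the
road's print binders, the X10b engine, and the CLAIMS `hrank` and `hL`. NO crux J₃, ANY Tamagawa depth; nothing booked.
[cite: MastellaZerman2026, Cor. 4.6] [cite: Miller2011LMS, Def. 1.1] -/
theorem bsdp_of_mem_allX10b_of_howard_of_mazurMainConjectureOnClassX10b
    (h46 : MastellaZerman2026.cor46_howardDivisibility_of_scalarImage.{0})
    (hYZ : thm57_thm59_bcs422_cgls513_generator_constantCoeff_of_heegnerDivisibility)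
    (h331 : thm331_anticyclotomicControl)
    (hGZ : ∀ (N : ℕ) [NeZero N] (W : WeierstrassCurve ℚ) (K : Type) [Field K] [NumberField K],
      gross_zagier N W K)
    (hKo : ∀ (N : ℕ) [NeZero N] (W : WeierstrassCurve ℚ) (K : Type) [Field K] [NumberField K],
      kolyvagin N W K)
    (hGr : greenberg_charValue_rankZero) (hGZK : rank_eq_analyticRank_of_analyticRank_le_one)
    (hmod : hasEntireLFunction_rat) (hpar : nonempty_modularParametrizationData)
    (hnf : exists_isNewformOf)
    (hMaz : mazur_not_dvd_maninConstant_of_odd) (hNS : integral_neronScaling_of_isGloballyMinimal)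
    {r : Record} (hr : r ∈ allX10b) (h1 : r.rank = 1) {W : WeierstrassCurve ℚ} [W.IsElliptic] [W.IsGloballyMinimal]
    (hI : integralModelInt W = r.intCurve) (hrank : W.analyticRank = r.rank)
    (hL : ∀ c ∈ howardCertsAllX10b, r.howardCheck c = true → (W.quadraticTwist (c.D : ℚ)).entireLFunction 1 ≠ 0)
    (hA3 : X10.MazurMainConjectureOnClassX10b) : BSDp W 3 := by
  obtain ⟨c, hc, hh⟩ := exists_howardCheck_of_mem_allX10b hr h1
  have hp3 : r.p = 3 := p_eq_three_of_mem_allX10b r hr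
  exact Record.bsdp_three_of_howardCheck_of_mazurMainConjectureOnClassX10b hI h46 hYZ h331 hGZ hKo hGr hGZK hmod hpar hnf hMaz hNS
    (check_of_mem_allX10b hr) (imageCert_of_mem_allX10b hr) hh hp3 hrank (hL c hc hh) hA3

end Summit.BirchSwinnertonDyer.Rank1Residual.X9.PrintCert

end
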